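import Summits.BirchSwinnertonDyer.Rank1Residual.ManinAdditive.CMPartnerLaw
import Literature.NumberTheory.EllipticCurves.ManinConstantGamma1Gamma0Comparison
import Literature.NumberTheory.EllipticCurves.ManinConstantGamma1Gamma0LedgerProofs
import Literature.NumberTheory.EllipticCurves.CuspFormLFunctionLevelConductorProofs
import Literature.NumberTheory.EllipticCurves.IsogenyDualInseparableProofs
import Literature.NumberTheory.EllipticCurves.IsogenyCompProofs
import Literature.NumberTheory.Automorphic.ShimuraCurveRibetTakahashiOptimalModularityProofs
import HarnessLib

/-!
# CM TWIN STEVENS-MINIMALITY, addendum 44.L: THE CONVERSE EDGE — C2 / C3 on a CM class ⟹ the partner `Γ₁`-law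
(cell `bsd-f2-manin`, planner `-es` g30, MEMO-es §44.L; T-es-47 FINAL part 4/4)

TYPER NOTE (typer g20, T-es-47 FINAL scope §3–§10).  SOURCE = HOME/es/g30/Sketch-es-g30.lean FINAL sha16 bf283a6a2da952a4
(879 l.; es: farm rc 0 · 0 err · 0 warn, axioms standard; BC7 21/21 CLEAN incl. Probe5 0be433c019f3b43e) §10 (l. 765–875) VERBATIM
except the namespace (`…ManinAdditive.KatoCurve.CMTwinMinimal`, continued from parts 1–3 `CMTwinStevensMinimal.lean` p716468,
`CMTwinStevensMinimalNetCount.lean` p716671, `CMPartnerLaw.lean` p717929 — the §3–§9 text of bf283a6a is byte-identical to the landed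
7254ca973fbc1207; the FINAL file only adds §10 and the six Literature `…Proofs` imports carried here) and this note.  CONTENT: two plain
`def … : Prop` SUPPORTS **`CMRootPartnerMaximalTwo`** / **`CMRootPartnerMaximalThree`** («the partner `E_{−4a}` / `E_{−27B}` is the
Stevens-MAXIMAL member of the class: its Néron lattice contains the Néron lattice of every globally minimal member»; classical
isogeny-class bookkeeping, census PARTNER-MAX-v1 44a85abecf72500f: 562/562 two-member `ℚ(i)` classes, 1713/1713 all-`j = 0` classes; the
four-member classes — twists of 32a/64a resp. 27a/36a — fail and are excluded by `a ≠ ±1` resp. the all-`j = 0` clause), nothing asserted;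
and three PROVED theorems: the pointwise converse `gammaOnePeriod_primeTo_mem_of_not_dvd_maninConstant` (`p ∤ c₀` + a lattice above
every Néron lattice of the class ⟹ every `X₁`-period has a prime-to-`p` multiple there, via `c₁ ∣ c₀`), and the CONVERSE EDGES
**`cmRootPartnerGammaOneLawTwo_of_maninOddAtFour`** (binder `hC2` = the universally quantified conclusion of the route crux
`Theses.ManinLocalTwoThree.ManinOddAtFour` after its four print-fact antecedents — spelled out, NOT imported, so this file stays
route-independent; ∧ `exists_isNewformOf` ∧ `exists_optimal_gamma1ParametrizationData` ∧ `CMRootPartnerMaximalTwo` ⟹ the body of E-es-139₂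
`CMRootPartnerGammaOneLawTwoLocal` at every root `a ∉ {±1}` with `4 ∣ N`) and **`cmPartnerGammaOneLawThree_of_maninPrimeToThreeAtNine`**
(binder `hC3` = conclusion of `ManinPrimeToThreeAtNine`; ⟹ the partner `Γ₁`-law on every all-`j = 0` class with `9 ∣ N`).  With §9's root
edges this makes «C2 on the CM slice» and E-es-139₂ EQUIVALENT modulo provable / classical / print inputs (es NET v3).  Refuter verdict
R-es-68 (§9–§10 + PARTNER-MAX-v1 second reading) pending at landing time (ref1 STATUS 12:23:06Z).  PARTITION 0 · beyond-print theorem: no ·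
bears_on stmt-BirchSwinnertonDyer-22967 / 22968 (CM slices) · BSD is not proved by this; C2, C3 OPEN.
-/

set_option autoImplicit false

noncomputable section

namespace Summit.BirchSwinnertonDyer.Rank1Residual.ManinAdditive.KatoCurve.CMTwinMinimal

open scoped MatrixGroups ModularForm
open CongruenceSubgroup WeierstrassCurve Literature.NumberTheory.EllipticCurves
  Literature.NumberTheory.EllipticCurves.ModularForms
  Summit.BirchSwinnertonDyer.Rank1Residual.ManinAdditive.KatoCurve.CMOptimal

/-! ## §10 (addendum 44.L) THE CONVERSE EDGE: C2 on a class ⟹ the partner `Γ₁`-law on that class (kernel, modulo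
named facts BCDT `exists_isNewformOf` and ČES/Stevens `exists_optimal_gamma1ParametrizationData`, and the classical
support «the partner is the Stevens-MAXIMAL member» — census PARTNER-MAX-v1: true in every 2-member class, i.e. every
root class `a ∉ {±1}` (p = 2) / every root class off the 27a- and 36a-families' own roots (p = 3)). -/
section ConverseEdge

variable {N : ℕ} [NeZero N]

/-- **Pointwise converse.**  A lattice-optimal `X₀(N)`-datum `D₀` with `p ∤ c₀`, and a lattice `L′` containing the Néron
lattice of every globally minimal curve isogenous to `W₀` ⟹ every `X₁`-period of `f` has a prime-to-`p` multiple in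
`L′` (namely `c₁ ·`, `c₁ ∣ c₀`). -/
theorem gammaOnePeriod_primeTo_mem_of_not_dvd_maninConstant
    (hex : exists_optimal_gamma1ParametrizationData) {p : ℤ}
    (W₀ : WeierstrassCurve ℚ) [W₀.IsElliptic] [W₀.IsGloballyMinimal] (D₀ : ModularParametrizationData W₀ N)
    (hD₀ : ∀ z ∈ D₀.L.lattice, ∃ w ∈ periodLattice D₀.f, z = D₀.c * w)
    (hodd : ¬ p ∣ D₀.maninConstant) (L' : PeriodPair)
    (hmax : ∀ (W₁ : WeierstrassCurve ℚ) [W₁.IsElliptic] [W₁.IsGloballyMinimal],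
      WeierstrassCurve.IsIsogenous W₁ W₀ → ∀ (L₁ : PeriodPair), IsNeronLatticeOf (W₁.baseChange ℂ) L₁ →
        ∀ z ∈ L₁.lattice, z ∈ L'.lattice) :
    ∀ z ∈ periodLatticeGamma1 D₀.f, ∃ s : ℤ, ¬ p ∣ s ∧ (s : ℂ) * z ∈ L'.lattice := by
  obtain ⟨W₁, hE₁, hM₁, D₁, hiso, h₁⟩ := hex W₀ D₀ hD₀
  have hdvd : D₁.maninConstant ∣ D₀.maninConstant := h₁.maninConstant_dvd_maninConstant D₀ hiso
  have hf : D₁.f = D₀.f := D₁.f_eq_of_isIsogenous D₀ hiso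
  intro z hz
  refine ⟨D₁.c, fun h => hodd (dvd_trans h hdvd), ?_⟩
  exact hmax W₁ hiso D₁.L D₁.isNeronLattice _ (D₁.smul_periodLatticeGamma1_le z (hf ▸ hz))

/-- SUPPORT `CMRootPartnerMaximalTwo` (classical: for squarefree `a ∉ {±1}` the `ℚ`-isogeny class of `E_a` is
`{E_a, E_{−4a}}` and `Λ(E_a) ⊆ Λ(E_{−4a})`; census PARTNER-MAX-v1 44a85abecf72500f: 562/562 two-member classes,
the 87 four-member classes = the twists of 32a/64a fail — hence `a ≠ ±1`). -/
def CMRootPartnerMaximalTwo : Prop :=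
  ∀ (V V' : WeierstrassCurve ℚ) [V.IsElliptic] [V.IsGloballyMinimal] [V'.IsElliptic] [V'.IsGloballyMinimal]
    (L' : PeriodPair),
    (∃ a : ℤ, Squarefree a ∧ a ≠ 1 ∧ a ≠ -1 ∧ V.c₄ = -48 * (a : ℚ) ∧ V.c₆ = 0) →
    WeierstrassCurve.IsIsogenous V V' → V'.c₄ = -4 * V.c₄ → V'.c₆ = 0 →
    IsNeronLatticeOf (V'.baseChange ℂ) L' →
    ∀ (W₁ : WeierstrassCurve ℚ) [W₁.IsElliptic] [W₁.IsGloballyMinimal],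
      WeierstrassCurve.IsIsogenous V W₁ → ∀ (L₁ : PeriodPair), IsNeronLatticeOf (W₁.baseChange ℂ) L₁ →
        ∀ z ∈ L₁.lattice, z ∈ L'.lattice

/-- **THE CONVERSE EDGE at p = 2 (kernel): C2 ⟹ E-es-139₂ off `a = ±1`.**  `ManinOddAtFour` (the route crux C2
itself, binder `hC2` = its literal body) ∧ BCDT ∧ `exists_optimal_gamma1ParametrizationData` ∧ `CMRootPartnerMaximalTwo` ⟹ the root partner `Γ₁`-law at
every root `a ∉ {±1}` whose level has `4 ∣ N` (all of them: `N = 32a²` or `64a²`).  With §9 this makes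
«C2 on the CM slice» and «E-es-139₂» EQUIVALENT modulo provable/classical/print inputs. -/
theorem cmRootPartnerGammaOneLawTwo_of_maninOddAtFour
    (hC2 : ∀ (W : WeierstrassCurve ℚ) [W.IsElliptic] [W.IsGloballyMinimal] {N : ℕ} [NeZero N]
      (D : ModularParametrizationData W N),
      (∀ z ∈ D.L.lattice, ∃ w ∈ periodLattice D.f, z = D.c * w) → 2 ^ 2 ∣ N → ¬ (2 : ℤ) ∣ D.maninConstant)
    (hnf : exists_isNewformOf) (hex : exists_optimal_gamma1ParametrizationData) (hmax : CMRootPartnerMaximalTwo)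
    (V V' : WeierstrassCurve ℚ) [V.IsElliptic] [V.IsGloballyMinimal] [V'.IsElliptic] [V'.IsGloballyMinimal]
    (f : CuspForm (Gamma0 N) 2) (L' : PeriodPair)
    (hroot : ∃ a : ℤ, Squarefree a ∧ a ≠ 1 ∧ a ≠ -1 ∧ V.c₄ = -48 * (a : ℚ) ∧ V.c₆ = 0)
    (hf : IsNewformOf V f) (hiso' : WeierstrassCurve.IsIsogenous V V') (hc₄ : V'.c₄ = -4 * V.c₄) (hc₆ : V'.c₆ = 0)
    (hL' : IsNeronLatticeOf (V'.baseChange ℂ) L') (h4 : 2 ^ 2 ∣ N) :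
    ∀ z ∈ periodLatticeGamma1 f, ∃ s : ℤ, ¬ (2 : ℤ) ∣ s ∧ (s : ℂ) * z ∈ L'.lattice := by
  have hN : V.conductorNorm ℤ = N := (IsNewformOf.level_eq_conductorNorm_of_exists_isNewformOf hnf hf).symm
  obtain ⟨W₀, hE₀, hM₀, D₀, hD₀f, hisoVW₀, hmin⟩ :=
    Literature.NumberTheory.Automorphic.exists_optimal_modularParametrizationData_of_isNewformOf' N V hN hf
  have hopt : ∀ z ∈ D₀.L.lattice, ∃ w ∈ periodLattice D₀.f, z = D₀.c * w :=
    D₀.latticeEq_of_forall_modularDegree_le fun W₂ _ D₂ h2 ↦ hmin W₂ D₂ (h2.trans hD₀f)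
  have hodd : ¬ (2 : ℤ) ∣ D₀.maninConstant := hC2 W₀ D₀ hopt h4
  have hmax' : ∀ (W₁ : WeierstrassCurve ℚ) [W₁.IsElliptic] [W₁.IsGloballyMinimal],
      WeierstrassCurve.IsIsogenous W₁ W₀ → ∀ (L₁ : PeriodPair), IsNeronLatticeOf (W₁.baseChange ℂ) L₁ →
        ∀ z ∈ L₁.lattice, z ∈ L'.lattice :=
    fun W₁ _ _ h₁₀ L₁ hL₁ ↦ hmax V V' L' hroot hiso' hc₄ hc₆ hL' W₁
      (hisoVW₀.trans' (WeierstrassCurve.IsIsogenous.symm_of_isElliptic h₁₀)) L₁ hL₁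
  rw [← hD₀f]
  exact gammaOnePeriod_primeTo_mem_of_not_dvd_maninConstant hex W₀ D₀ hopt hodd L' hmax'

/-- SUPPORT `CMRootPartnerMaximalThree` (classical; census PARTNER-MAX-v1: 1713/1713 classes all of whose members have
`j = 0` — the 135 four-member classes, i.e. the twists of 27a and 36a, fail and are excluded by the all-`j = 0` clause). -/
def CMRootPartnerMaximalThree : Prop :=
  ∀ (V V' : WeierstrassCurve ℚ) [V.IsElliptic] [V.IsGloballyMinimal] [V'.IsElliptic] [V'.IsGloballyMinimal]
    (L' : PeriodPair),
    V.j = 0 → (∀ (W₁ : WeierstrassCurve ℚ) [W₁.IsElliptic] [W₁.IsGloballyMinimal],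
      WeierstrassCurve.IsIsogenous V W₁ → W₁.j = 0) →
    WeierstrassCurve.IsIsogenous V V' → V'.c₄ = 0 → V'.c₆ = -27 * V.c₆ →
    IsNeronLatticeOf (V'.baseChange ℂ) L' →
    ∀ (W₁ : WeierstrassCurve ℚ) [W₁.IsElliptic] [W₁.IsGloballyMinimal],
      WeierstrassCurve.IsIsogenous V W₁ → ∀ (L₁ : PeriodPair), IsNeronLatticeOf (W₁.baseChange ℂ) L₁ →
        ∀ z ∈ L₁.lattice, z ∈ L'.lattice

/-- **THE CONVERSE EDGE at p = 3 (kernel): C3 ⟹ the partner `Γ₁`-law on every all-`j = 0` class** (binder `hC3` =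
the literal body of `ManinPrimeToThreeAtNine`). -/
theorem cmPartnerGammaOneLawThree_of_maninPrimeToThreeAtNine
    (hC3 : ∀ (W : WeierstrassCurve ℚ) [W.IsElliptic] [W.IsGloballyMinimal] {N : ℕ} [NeZero N]
      (D : ModularParametrizationData W N),
      (∀ z ∈ D.L.lattice, ∃ w ∈ periodLattice D.f, z = D.c * w) → 3 ^ 2 ∣ N → ¬ (3 : ℤ) ∣ D.maninConstant)
    (hnf : exists_isNewformOf) (hex : exists_optimal_gamma1ParametrizationData) (hmax : CMRootPartnerMaximalThree)
    (V V' : WeierstrassCurve ℚ) [V.IsElliptic] [V.IsGloballyMinimal] [V'.IsElliptic] [V'.IsGloballyMinimal]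
    (f : CuspForm (Gamma0 N) 2) (L' : PeriodPair) (hjV : V.j = 0)
    (hall : ∀ (W₁ : WeierstrassCurve ℚ) [W₁.IsElliptic] [W₁.IsGloballyMinimal],
      WeierstrassCurve.IsIsogenous V W₁ → W₁.j = 0)
    (hf : IsNewformOf V f) (hiso' : WeierstrassCurve.IsIsogenous V V') (hc₄ : V'.c₄ = 0) (hc₆ : V'.c₆ = -27 * V.c₆)
    (hL' : IsNeronLatticeOf (V'.baseChange ℂ) L') (h9 : 3 ^ 2 ∣ N) :
    ∀ z ∈ periodLatticeGamma1 f, ∃ s : ℤ, ¬ (3 : ℤ) ∣ s ∧ (s : ℂ) * z ∈ L'.lattice := by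
  have hN : V.conductorNorm ℤ = N := (IsNewformOf.level_eq_conductorNorm_of_exists_isNewformOf hnf hf).symm
  obtain ⟨W₀, hE₀, hM₀, D₀, hD₀f, hisoVW₀, hmin⟩ :=
    Literature.NumberTheory.Automorphic.exists_optimal_modularParametrizationData_of_isNewformOf' N V hN hf
  have hopt : ∀ z ∈ D₀.L.lattice, ∃ w ∈ periodLattice D₀.f, z = D₀.c * w :=
    D₀.latticeEq_of_forall_modularDegree_le fun W₂ _ D₂ h2 ↦ hmin W₂ D₂ (h2.trans hD₀f)
  have hodd : ¬ (3 : ℤ) ∣ D₀.maninConstant := hC3 W₀ D₀ hopt h9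
  have hmax' : ∀ (W₁ : WeierstrassCurve ℚ) [W₁.IsElliptic] [W₁.IsGloballyMinimal],
      WeierstrassCurve.IsIsogenous W₁ W₀ → ∀ (L₁ : PeriodPair), IsNeronLatticeOf (W₁.baseChange ℂ) L₁ →
        ∀ z ∈ L₁.lattice, z ∈ L'.lattice :=
    fun W₁ _ _ h₁₀ L₁ hL₁ ↦ hmax V V' L' hjV hall hiso' hc₄ hc₆ hL' W₁
      (hisoVW₀.trans' (WeierstrassCurve.IsIsogenous.symm_of_isElliptic h₁₀)) L₁ hL₁
  rw [← hD₀f]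
  exact gammaOnePeriod_primeTo_mem_of_not_dvd_maninConstant hex W₀ D₀ hopt hodd L' hmax'

end ConverseEdge

end Summit.BirchSwinnertonDyer.Rank1Residual.ManinAdditive.KatoCurve.CMTwinMinimal

end
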